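import Literature.Geometry.Riemannian.RicciFlowScaledChartCauchy
import HarnessLib

/-!
# Uniform `Cᵐ` bounds and the Cauchy property of the scaled chart representative
(helper file for stub `stub_smoothRoundLimit`, layer S4b `helper_scaledChart_bounds`, line
`margerin-cone-hamilton-rails`, crux `EntropyRung.ChangGurskyYang`, item stmt-SmoothPoincare4-10834)

Along a Ricci flow of Riemannian metrics `g(t)` on `[0, T)` on a closed manifold with
`4`-dimensional model, the chart data produced by `helper_scaledChart_data` at every point `z` —
two-sided bounds of the scaled representative `G̃(t) = (T − t)⁻¹ · chartRep (𝓡 4) g z t`, decay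
`C₀(T − t)^{δ₀}` of the Einstein defect `Ric(G) − G/(2(T − t))` and decay `C_k(T − t)^{δ_k}` of
all components of `∇ᵏ⁺¹Ric` on a closed chart ball — give, on a smaller chart ball and for later
times, UNIFORM BOUNDS on all `∂ᵐ_y G̃(·, t)` and their UNIFORM CAUCHY PROPERTY as `t ↑ T`
(Hamilton 1982, §14, Lemma 14.2 and §17, Cor. 17.10; Topping 2006, pp. 47–48; Chow–Knopf 2004,
§6.7). This is the specialisation to the model `𝓡 4` of
`Literature.Geometry.Riemannian.IsRicciFlow.scaledChartRep_bounded_and_cauchy`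
(`RicciFlowScaledChartCauchy.lean`), which rests on the graded induction with decay weights
`MetricCoord.spatiallyBddUpTo_scaled_of_covariantRicciDecay` (`RicciFlowScaledChartBounds.lean`)
and the integrable-rate integration in time `spatiallyBddUpTo_of_dT_rpow` /
`dYk_cauchy_of_dT_rpow` (`EvolutionDerivBoundsIntegrable.lean`).

## References

* R. S. Hamilton, *Three-manifolds with positive Ricci curvature*, J. Differential Geom. 17
  (1982) 255–306, §14, Lemma 14.2; §17, Cor. 17.10. [Hamilton1982]
* P. Topping, *Lectures on the Ricci flow*, LMS Lecture Note Series 325, CUP 2006, §5.3,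
  pp. 47–48. [Topping2006]
* B. Chow, D. Knopf, *The Ricci flow: an introduction*, AMS 2004, §6.7. [ChowKnopf2004]
-/

noncomputable section

-- every `Summit.SmoothPoincare4.SmoothPoincare4.…` name repeats the summit = sub-problem segment (D-0017 layout)
set_option linter.dupNamespace false
set_option maxSynthPendingDepth 3

open Set Function Filter
open scoped Manifold ContDiff Topology

namespace Summit.SmoothPoincare4.SmoothPoincare4.Theorems.MargerinRails

open Literature.Geometry.Riemannian
open Literature.Geometry.Lorentzian Literature.Geometry.Lorentzian.PseudoRiemannianMetric

/-- **Uniform `Cᵐ` bounds and the Cauchy property as `t ↑ T` of the scaled chart representative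
`G̃(t) = (T − t)⁻¹ · chartRep (𝓡 4) g z t`** (layer S4b of `stub_smoothRoundLimit`): from the
chart data (two-sided bounds of `G̃`, decay of the Einstein defect and of the components of all
`∇ᵏ⁺¹Ric` on a closed chart ball near `T`) at every point, on a smaller chart ball and for later
times all `∂ᵐ_y G̃(·, t)` are bounded and uniformly Cauchy as `t ↑ T` (Hamilton 1982, §14,
Lemma 14.2 / §17, Cor. 17.10 by the graded induction of Chow–Knopf 2004, §6.7 with integrable
rates; `IsRicciFlow.scaledChartRep_bounded_and_cauchy` specialised to the model `𝓡 4`).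
[cite: Hamilton1982, §14, Lemma 14.2] [cite: Hamilton1982, §17, Cor. 17.10]
[cite: Topping2006, §5.3, pp. 47–48] [cite: ChowKnopf2004, §6.7] -/
theorem helper_scaledChart_bounds : ∀ (M : Type) [TopologicalSpace M] [T2Space M] [SecondCountableTopology M] [ChartedSpace (EuclideanSpace ℝ (Fin 4)) M] [IsManifold (𝓡 4) ∞ M] [CompactSpace M] (g : ℝ → PseudoRiemannianMetric (𝓡 4) ∞ (EuclideanSpace ℝ (Fin 4)) (TangentSpace (𝓡 4) : M → Type _)) (cov : ℝ → CovariantDerivative (𝓡 4) (EuclideanSpace ℝ (Fin 4)) (TangentSpace (𝓡 4) : M → Type _)) (T : ℝ), 0 < T → IsRicciFlow g cov (Ico 0 T) → (∀ t ∈ Ico 0 T, (g t).IsRiemannian) → (∀ z : M, ∃ r t₁ lam Λ : ℝ, 0 < r ∧ t₁ ∈ Ico 0 T ∧ 0 < lam ∧ Metric.closedBall (extChartAt (𝓡 4) z z) r ⊆ (extChartAt (𝓡 4) z).target ∧ (∀ t ∈ Ico t₁ T, ∀ y ∈ Metric.closedBall (extChartAt (𝓡 4) z z) r, (∀ v : EuclideanSpace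 ℝ (Fin 4), lam * ‖v‖ ^ 2 ≤ (T - t)⁻¹ * chartRep (𝓡 4) g z t y v v) ∧ ‖(T - t)⁻¹ • chartRep (𝓡 4) g z t y‖ ≤ Λ) ∧ (∃ δ₀ C₀ : ℝ, 0 < δ₀ ∧ ∀ t ∈ Ico t₁ T, ∀ y ∈ Metric.closedBall (extChartAt (𝓡 4) z z) r, ‖MetricCoord.ricAt (chartRep (𝓡 4) g z t) y - (2 * (T - t))⁻¹ • chartRep (𝓡 4) g z t y‖ ≤ C₀ * (T - t) ^ δ₀) ∧ (∀ k : ℕ, ∃ δk Ck : ℝ, 0 < δk ∧ ∀ t ∈ Ico t₁ T, ∀ y ∈ Metric.closedBall (extChartAt (𝓡 4) z z) r, ∀ J : Fin (k + 1) ⊕ Fin 2 → Fin (Module.finrank ℝ (EuclideanSpace ℝ (Fin 4))), |MetricCoord.tcovIter (chartRep (𝓡 4) g z t) (Module.finBasis ℝ (EuclideanSpace ℝ (Fin 4))) (k + 1) (MetricCoord.ric2 (chartRep (𝓡 4) g z t) (Module.finBasis ℝ (EuclideanSpace ℝ (Fin 4)))) y J| ≤ Ck * (T - t) ^ δk)) →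 ∀ z : M, ∃ r t₁ lam : ℝ, 0 < r ∧ t₁ ∈ Ico 0 T ∧ 0 < lam ∧ Metric.closedBall (extChartAt (𝓡 4) z z) r ⊆ (extChartAt (𝓡 4) z).target ∧ (∀ t ∈ Ico t₁ T, ∀ y ∈ Metric.closedBall (extChartAt (𝓡 4) z z) r, ∀ v : EuclideanSpace ℝ (Fin 4), lam * ‖v‖ ^ 2 ≤ (T - t)⁻¹ * chartRep (𝓡 4) g z t y v v) ∧ (∀ m : ℕ, ∃ Cm : ℝ, ∀ t ∈ Ico t₁ T, ∀ y ∈ Metric.ball (extChartAt (𝓡 4) z z) r, ‖iteratedFDeriv ℝ m (fun y : EuclideanSpace ℝ (Fin 4) ↦ (T - t)⁻¹ • chartRep (𝓡 4) g z t y) y‖ ≤ Cm) ∧ (∀ m : ℕ, ∀ ε : ℝ, 0 < ε → ∃ t₂ ∈ Ico t₁ T, ∀ t ∈ Ico t₂ T, ∀ t' ∈ Ico t₂ T, ∀ y ∈ Metric.ball (extChartAt (𝓡 4) z z) r, ‖iteratedFDeriv ℝ m (fun y : EuclideanSpace ℝ (Fin 4) ↦ (T - t)⁻¹ • chartRep (𝓡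 4) g z t y) y - iteratedFDeriv ℝ m (fun y : EuclideanSpace ℝ (Fin 4) ↦ (T - t')⁻¹ • chartRep (𝓡 4) g z t' y) y‖ ≤ ε) := by
  intro M _ _ _ _ _ _ g cov T hT hflow _ hdata z
  exact hflow.scaledChartRep_bounded_and_cauchy hT hdata z

end Summit.SmoothPoincare4.SmoothPoincare4.Theorems.MargerinRails

end
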